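import Summits.KontsevichZagierPeriods.KontsevichZagierPeriods.Theorems.KzOnePeriodsG2SCMOvals

/-!
# G2S derivations, part 9: the chart `x ≠ 0` of `C_{a,b,c}` as an affine curve in `𝔸³`

Sub-problem `KzOnePeriods` — the theorem of Huber–Wüstholz [cite: HuberWustholz2022, Thm 13.3 (2)
(p. 121)]: every `ℚ̄`-linear relation between 1-periods is a consequence of (R1) bilinearity,
(R2) forms vanishing on the curve, (R3) exactness, (R4) functoriality along morphisms of pairs and
(R5) homotopy [cite: HuberWustholz2022, §13.1 (A)–(B) (p. 120)].  Parts 4–8 derive the relations of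
kz1p's G2S corpus coming from the FIRST elliptic quotient `φ_s = (x² + s, y)` of the even sextic model
`C_{a,b,c} : y² = f(x) = x⁶ + a x⁴ + b x² + c`.  The SECOND quotient `φ₂ = (c/x² + b/3, c·y/x³)`
(corpus case G2-09) is not a polynomial map of the plane, so (R4) does not apply to it on `C_{a,b,c}`
directly.  This part supplies the chart on which it becomes polynomial (part 10):

* the **chart model** `C^w_{a,b,c} = {y² = f(x), x·w = 1} ⊂ 𝔸³` of the open set `x ≠ 0` of `C`
  (`mem_pointsW_iff`, `mem_tangentSpaceW_iff`) and its smoothness over `ℚ̄` (`smoothW`: the Jacobian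
  rows `(−f′, 2y, 0)`, `(w, 0, x)` are independent at every point; no point is isolated, by transport
  of part 1 `smooth` along the homeomorphism `(x, y) ↦ (x, y, 1/x)`);
* the **projection** `pr = (x, y) : C^w → C` as a polynomial map over `ℚ̄` (`proj_mem`; (R4) relates
  `(C^w, pr^*θ, γ^w)` and `(C, θ, γ)`), the chain rule `(pr^*ω)(v) = ω(v₀, v₁)` (`proj_pair`, from
  the general pairing formula `formPullback_pair`), and the **lift** `γ^w = (x, y, 1/x)` of every path
  of `C` avoiding `x = 0` (`exists_chartPath`: `C¹`, algebraic end points, `pr ∘ γ^w = γ`).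

All statements quantify over `C¹` paths with algebraic end points (`CurvePath`).  No definitions
(local notation only), no new axioms; no statement of the programme is cited — the one citation is the
published theorem whose relation span the G2S files instantiate.
-/

noncomputable section

open MvPolynomial Set Complex Filter Topology
open Literature.NumberTheory.Transcendental Literature.NumberTheory.Transcendental.CurvePeriods
open Summit.KontsevichZagierPeriods.KzOnePeriods.E1Derivation

namespace Summit.KontsevichZagierPeriods.KzOnePeriods.G2SDerivation

/-- The even sextic `f = x⁶ + a x⁴ + b x² + c ∈ ℂ[x, y]`. -/
local notation3 (prettyPrint := false) "fS[" a ", " b ", " c "]" =>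
  ((X 0 : MvPolynomial (Fin 2) ℂ) ^ 6 + C a * X 0 ^ 4 + C b * X 0 ^ 2 + C c)

/-- The affine plane model `C_{a,b,c} = {y² = f(x)} ⊂ 𝔸²`. -/
local notation3 (prettyPrint := false) "Cpl[" a ", " b ", " c "]" =>
  (⟨2, 1, ![(X 1 : MvPolynomial (Fin 2) ℂ) ^ 2 - fS[a, b, c]]⟩ : CurveData)

/-- The Bézout identity `U f + V f′ = 1` (scalar form). -/
local notation3 (prettyPrint := false) "Bez[" a ", " b ", " c ", " μ ", " ν "]" =>
  (∀ x : ℂ, (∑ k : Fin 3, μ k * x ^ (2 * (k : ℕ))) * (x ^ 6 + a * x ^ 4 + b * x ^ 2 + c) +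
    (∑ k : Fin 3, ν k * x ^ (2 * (k : ℕ) + 1)) * (6 * x ^ 5 + 4 * a * x ^ 3 + 2 * b * x) = 1)

/-- The even sextic `f` in `ℂ[x, y, w]`. -/
local notation3 (prettyPrint := false) "fS₃[" a ", " b ", " c "]" =>
  ((X 0 : MvPolynomial (Fin 3) ℂ) ^ 6 + C a * X 0 ^ 4 + C b * X 0 ^ 2 + C c)

/-- The chart model `C^w_{a,b,c} = {y² = f(x), x·w = 1} ⊂ 𝔸³` of the open set `x ≠ 0` of `C_{a,b,c}`. -/
local notation3 (prettyPrint := false) "Cw[" a ", " b ", " c "]" =>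
  (⟨3, 2, ![(X 1 : MvPolynomial (Fin 3) ℂ) ^ 2 - fS₃[a, b, c], X 0 * X 2 - 1]⟩ : CurveData)

/-- The projection `pr = (x, y) : C^w_{a,b,c} → C_{a,b,c}` as a polynomial map. -/
local notation3 (prettyPrint := false) "proj" => (![X 0, X 1] : Fin 2 → MvPolynomial (Fin 3) ℂ)

variable {a b c : ℂ}

/-! ### The chart model `C^w_{a,b,c} ⊂ 𝔸³` -/

/-- `z ∈ C^w ↔ z₁² = f(z₀) ∧ z₀ z₂ = 1`. -/
theorem mem_pointsW_iff (z : Fin 3 → ℂ) :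
    z ∈ Cw[a, b, c].points ↔
      z 1 ^ 2 = z 0 ^ 6 + a * z 0 ^ 4 + b * z 0 ^ 2 + c ∧ z 0 * z 2 = 1 := by
  refine (CurveData.mem_points (Z := Cw[a, b, c]) (z := z)).trans ?_
  rw [show (∀ j : Fin (Cw[a, b, c]).m, eval z ((Cw[a, b, c]).F j) = 0) ↔
      ∀ j : Fin 2, eval z ((![(X 1 : MvPolynomial (Fin 3) ℂ) ^ 2 - fS₃[a, b, c], X 0 * X 2 - 1] :
        Fin 2 → MvPolynomial (Fin 3) ℂ) j) = 0 from Iff.rfl]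
  simp [Fin.forall_fin_two, sub_eq_zero]

/-- The gradient of `y² − f`: `(−f′(x), 2y, 0)`. -/
theorem gradientW_zero (z : Fin 3 → ℂ) :
    Cw[a, b, c].gradient 0 z = ![-(6 * z 0 ^ 5 + 4 * a * z 0 ^ 3 + 2 * b * z 0), 2 * z 1, 0] := by
  funext k
  simp only [CurveData.gradient, Matrix.cons_val_zero]
  fin_cases k
  · simp [pderiv_X_of_ne (show (1 : Fin 3) ≠ 0 by decide)]
    ring
  · simp [pderiv_X_of_ne (show (0 : Fin 3) ≠ 1 by decide)]
  · simp [pderiv_X_of_ne (show (0 : Fin 3) ≠ 2 by decide),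
      pderiv_X_of_ne (show (1 : Fin 3) ≠ 2 by decide)]

/-- The gradient of `x w − 1`: `(w, 0, x)`. -/
theorem gradientW_one (z : Fin 3 → ℂ) : Cw[a, b, c].gradient 1 z = ![z 2, 0, z 0] := by
  funext k
  simp only [CurveData.gradient, Matrix.cons_val_one]
  fin_cases k
  · simp [pderiv_X_of_ne (show (2 : Fin 3) ≠ 0 by decide)]
  · simp [pderiv_X_of_ne (show (0 : Fin 3) ≠ 1 by decide),
      pderiv_X_of_ne (show (2 : Fin 3) ≠ 1 by decide)]
  · simp [pderiv_X_of_ne (show (0 : Fin 3) ≠ 2 by decide)]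

/-- The tangent line at `z`: `−f′(z₀) v₀ + 2 z₁ v₁ = 0` and `z₂ v₀ + z₀ v₂ = 0`. -/
theorem mem_tangentSpaceW_iff (z v : Fin 3 → ℂ) :
    v ∈ Cw[a, b, c].tangentSpace z ↔
      -(6 * z 0 ^ 5 + 4 * a * z 0 ^ 3 + 2 * b * z 0) * v 0 + 2 * z 1 * v 1 = 0 ∧
        z 2 * v 0 + z 0 * v 2 = 0 := by
  simp only [CurveData.tangentSpace, mem_setOf_eq]
  rw [show (∀ j : Fin (Cw[a, b, c]).m, ∑ i, (Cw[a, b, c]).gradient j z i * v i = 0) ↔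
      ∀ j : Fin 2, ∑ i, (Cw[a, b, c]).gradient j z i * v i = 0 from Iff.rfl, Fin.forall_fin_two]
  rw [show (0 : Fin 2) = (0 : Fin (Cw[a, b, c]).m) from rfl,
    show (1 : Fin 2) = (1 : Fin (Cw[a, b, c]).m) from rfl, gradientW_zero, gradientW_one]
  simp only [Fin.sum_univ_three, Matrix.cons_val_zero, Matrix.cons_val_one, Matrix.cons_val_two,
    Matrix.head_cons, Matrix.tail_cons, zero_mul, add_zero]

/-- `f ∈ ℂ[x, y, w]` has algebraic coefficients when `a, b, c ∈ ℚ̄`. -/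
theorem hasAlgCoeffs_fS₃ (ha : IsAlgebraic ℚ a) (hb : IsAlgebraic ℚ b) (hc : IsAlgebraic ℚ c) :
    HasAlgCoeffs fS₃[a, b, c] :=
  ((((hasAlgCoeffs_X (n := 3) 0).pow 6).add ((hasAlgCoeffs_C ha).mul ((hasAlgCoeffs_X 0).pow 4))).add
    ((hasAlgCoeffs_C hb).mul ((hasAlgCoeffs_X 0).pow 2))).add (hasAlgCoeffs_C hc)

/-- The equations of `C^w` have algebraic coefficients. -/
theorem hasAlgCoeffs_FW (ha : IsAlgebraic ℚ a) (hb : IsAlgebraic ℚ b) (hc : IsAlgebraic ℚ c) :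
    ∀ j, HasAlgCoeffs (Cw[a, b, c].F j) := by
  intro j
  fin_cases j
  · simpa using ((hasAlgCoeffs_X (n := 3) 1).pow 2).sub (hasAlgCoeffs_fS₃ ha hb hc)
  · simpa using ((hasAlgCoeffs_X (n := 3) 0).mul (hasAlgCoeffs_X 2)).sub hasAlgCoeffs_one

/-- **Smoothness of the chart model.**  For algebraic `a, b, c` and a Bézout pair `U f + V f′ = 1`,
`C^w_{a,b,c}` is a smooth affine curve over `ℚ̄`: the Jacobian rows `(−f′(x), 2y, 0)` and `(w, 0, x)`
are independent at every point (`x ≠ 0`; `(f′(x), y) ≠ (0, 0)` by Bézout), and no point is isolated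
(the homeomorphism `(x, y) ↦ (x, y, 1/x)` of `{x ≠ 0} ⊂ C_{a,b,c}` onto `C^w`, part 1 `smooth`). -/
theorem smoothW (ha : IsAlgebraic ℚ a) (hb : IsAlgebraic ℚ b) (hc : IsAlgebraic ℚ c)
    {μ ν : Fin 3 → ℂ} (hbez : Bez[a, b, c, μ, ν]) : Cw[a, b, c].IsSmoothAffineCurve where
  algebraic := hasAlgCoeffs_FW ha hb hc
  rank_eq z hz := by
    obtain ⟨hz1, hz2⟩ := (mem_pointsW_iff z).1 hz
    have hx : z 0 ≠ 0 := left_ne_zero_of_mul_eq_one hz2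
    have hfam : (fun j : Fin (Cw[a, b, c]).m => Cw[a, b, c].gradient j z) =
        ![![-(6 * z 0 ^ 5 + 4 * a * z 0 ^ 3 + 2 * b * z 0), 2 * z 1, 0], ![z 2, 0, z 0]] := by
      funext j
      fin_cases j
      · exact gradientW_zero z
      · exact gradientW_one z
    rw [hfam, finrank_span_eq_card]
    · rfl
    rw [LinearIndependent.pair_iff]
    intro s t hst
    have h0 := congrFun hst 0
    have h1 := congrFun hst 1
    have h2 := congrFun hst 2
    simp only [Pi.add_apply, Pi.smul_apply, Matrix.cons_val_zero, Matrix.cons_val_one,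
      Matrix.cons_val_two, Matrix.head_cons, Matrix.tail_cons, smul_eq_mul, mul_zero, add_zero,
      zero_add, Pi.zero_apply] at h0 h1 h2
    have ht : t = 0 := (mul_eq_zero.1 h2).resolve_right hx
    refine ⟨by_contra fun hs => ?_, ht⟩
    rw [ht, zero_mul, add_zero] at h0
    have hf' : 6 * z 0 ^ 5 + 4 * a * z 0 ^ 3 + 2 * b * z 0 = 0 := by
      have := (mul_eq_zero.1 h0).resolve_left hs
      rwa [neg_eq_zero] at this
    have hy : z 1 = 0 := by
      have := (mul_eq_zero.1 h1).resolve_left hs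
      simpa using this
    have hf : z 0 ^ 6 + a * z 0 ^ 4 + b * z 0 ^ 2 + c = 0 := by rw [← hz1, hy]; ring
    have hB := hbez (z 0)
    rw [hf', hf, mul_zero, mul_zero, add_zero] at hB
    exact zero_ne_one hB
  not_isolated z hz := by
    obtain ⟨hz1, hz2⟩ := (mem_pointsW_iff z).1 hz
    have hx : z 0 ≠ 0 := left_ne_zero_of_mul_eq_one hz2
    have hw : (z 0)⁻¹ = z 2 := inv_eq_of_mul_eq_one_right hz2
    -- the point of the plane model under `z`
    obtain ⟨p, hp⟩ : ∃ p : Fin 2 → ℂ, p = ![z 0, z 1] := ⟨_, rfl⟩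
    have hp0 : p 0 = z 0 := by rw [hp]; rfl
    have hp1 : p 1 = z 1 := by rw [hp]; rfl
    have hpC : p ∈ Cpl[a, b, c].points := (mem_points_iff p).2 (by rw [hp0, hp1]; exact hz1)
    have hcl := (smooth ha hb hc hbez).not_isolated p hpC
    -- the chart `(x, y) ↦ (x, y, 1/x)`
    obtain ⟨h, hh⟩ : ∃ h : (Fin 2 → ℂ) → (Fin 3 → ℂ), h = fun q => ![q 0, q 1, (q 0)⁻¹] := ⟨_, rfl⟩
    have hpx : p 0 ≠ 0 := by rw [hp0]; exact hx
    have h0c : ContinuousAt (fun q : Fin 2 → ℂ => q 0) p := (continuous_apply 0).continuousAt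
    have h1c : ContinuousAt (fun q : Fin 2 → ℂ => q 1) p := (continuous_apply 1).continuousAt
    have h2c : ContinuousAt (fun q : Fin 2 → ℂ => (q 0)⁻¹) p := h0c.inv₀ hpx
    have hcont : ContinuousAt h p := by
      rw [hh, continuousAt_pi]
      intro k
      fin_cases k
      · exact h0c
      · exact h1c
      · exact h2c
    have hhp : h p = z := by
      funext k
      fin_cases k
      · simp [hh, hp0]
      · simp [hh, hp1]
      · simp [hh, hp0, hw]
    have htend : Tendsto h (𝓝 p) (𝓝 z) := hhp ▸ hcont.tendsto
    rw [mem_closure_iff_frequently] at hcl ⊢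
    have hev : ∀ᶠ q in 𝓝 p, q 0 ≠ 0 := (continuous_apply 0).continuousAt.eventually_ne hpx
    have hfr : ∃ᶠ q in 𝓝 p, h q ∈ Cw[a, b, c].points \ {z} := by
      refine (hcl.and_eventually hev).mono ?_
      rintro q ⟨⟨hqC, hqp⟩, hq0⟩
      have hqC' := (mem_points_iff q).1 hqC
      refine ⟨(mem_pointsW_iff _).2 ⟨?_, ?_⟩, fun hqz => hqp ?_⟩
      · simpa [hh] using hqC'
      · simp [hh, mul_inv_cancel₀ hq0]
      · have e0 := congrFun hqz 0
        have e1 := congrFun hqz 1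
        simp only [hh, Matrix.cons_val_zero, Matrix.cons_val_one] at e0 e1
        show q = p
        funext k
        fin_cases k
        · simpa [hp0] using e0
        · simpa [hp1] using e1
    exact htend.frequently hfr

/-! ### The projection `pr : C^w → C` and the lift of paths avoiding `x = 0` -/

/-- `pr` is defined over `ℚ̄`. -/
theorem hasAlgCoeffs_proj : ∀ j, HasAlgCoeffs ((proj) j) := fun j => by
  fin_cases j
  · simpa using hasAlgCoeffs_X (n := 3) 0
  · simpa using hasAlgCoeffs_X (n := 3) 1

/-- `pr(z) = (z₀, z₁)`. -/
theorem eval_proj (z : Fin 3 → ℂ) : (fun j => eval z ((proj) j)) = ![z 0, z 1] := by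
  funext j
  fin_cases j <;> simp

/-- `pr` maps `C^w` into `C`. -/
theorem proj_mem : ∀ z ∈ Cw[a, b, c].points, (fun j => eval z ((proj) j)) ∈ Cpl[a, b, c].points := by
  intro z hz
  rw [eval_proj, mem_points_iff]
  simpa using ((mem_pointsW_iff z).1 hz).1

/-- **The lift to the chart.**  A path `γ = (x, y)` on `C_{a,b,c}` with `x ≠ 0` on `[0, 1]` lifts to the
path `γ^w = (x, y, 1/x)` on `C^w_{a,b,c}` (`C¹`, algebraic end points), with `pr ∘ γ^w = γ`. -/
theorem exists_chartPath {γ : CurvePath Cpl[a, b, c]} (h0 : ∀ t ∈ Icc (0 : ℝ) 1, γ.toFun t 0 ≠ 0) :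
    ∃ γw : CurvePath Cw[a, b, c], ∀ t, γw.toFun t = ![γ.toFun t 0, γ.toFun t 1, (γ.toFun t 0)⁻¹] := by
  have hγ := contDiffOn_pi.1 γ.contDiffOn
  have hI0 : (0 : ℝ) ∈ Icc (0 : ℝ) 1 := ⟨le_rfl, zero_le_one⟩
  have hI1 : (1 : ℝ) ∈ Icc (0 : ℝ) 1 := ⟨zero_le_one, le_rfl⟩
  have halg : ∀ {t}, (∀ i, IsAlgebraic ℚ (γ.toFun t i)) →
      ∀ i, IsAlgebraic ℚ ((![γ.toFun t 0, γ.toFun t 1, (γ.toFun t 0)⁻¹] : Fin 3 → ℂ) i) := by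
    intro t hal i
    fin_cases i
    · simpa using hal 0
    · simpa using hal 1
    · simpa using (hal 0).inv
  refine ⟨{ toFun := fun t => ![γ.toFun t 0, γ.toFun t 1, (γ.toFun t 0)⁻¹]
            contDiffOn := ?_
            mem_points := ?_
            algebraic_zero := halg γ.algebraic_zero
            algebraic_one := halg γ.algebraic_one }, fun t => rfl⟩
  · rw [contDiffOn_pi]
    intro k
    fin_cases k
    · exact hγ 0
    · exact hγ 1
    · exact (hγ 0).inv h0
  · intro t ht
    refine (mem_pointsW_iff _).2 ⟨?_, ?_⟩
    · simpa using (mem_points_iff _).1 (γ.mem_points t ht)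
    · simp [mul_inv_cancel₀ (h0 t ht)]

/-! ### Chain rule: pairing a pulled-back form with a vector -/

/-- `(f^*ω)(z)(v) = Σ_j ω_j(f z) · (Σ_i ∂_i f_j(z) v_i)`. -/
theorem formPullback_pair {n n' : ℕ} (f : Fin n' → MvPolynomial (Fin n) ℂ)
    (ω : Fin n' → MvPolynomial (Fin n') ℂ) (z v : Fin n → ℂ) :
    ∑ i, eval z (formPullback f ω i) * v i =
      ∑ j, eval (fun j => eval z (f j)) (ω j) * ∑ i, eval z (pderiv i (f j)) * v i := by
  simp only [formPullback, map_sum, map_mul, eval_bind₁_eq, Finset.sum_mul, Finset.mul_sum]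
  rw [Finset.sum_comm]
  refine Finset.sum_congr rfl fun j _ => Finset.sum_congr rfl fun i _ => ?_
  ring

/-- The chain rule for `pr`: `(pr^*ω)(z)(v) = ω(z₀, z₁)(v₀, v₁)`. -/
theorem proj_pair (ω : Fin 2 → MvPolynomial (Fin 2) ℂ) (z v : Fin 3 → ℂ) :
    ∑ i, eval z (formPullback (proj) ω i) * v i =
      eval (![z 0, z 1]) (ω 0) * v 0 + eval (![z 0, z 1]) (ω 1) * v 1 := by
  rw [formPullback_pair, eval_proj]
  simp [Fin.sum_univ_two, Fin.sum_univ_three, pderiv_X]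

end Summit.KontsevichZagierPeriods.KzOnePeriods.G2SDerivation

end
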